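import Literature.NumberTheory.Automorphic.RegularAlgebraicCuspidalHeckePointProofs
import Literature.NumberTheory.Automorphic.TwistedQuotientIntFunHeckeReduction
import Literature.NumberTheory.Automorphic.ArithmeticQuotientTwistedComparison
import Literature.NumberTheory.Automorphic.ArithmeticQuotientCohomologyProd
import Mathlib.Algebra.Homology.ShortComplex.Linear
import HarnessLib

/-!
# An integral Hecke eigenclass of bounded content is a point of `Spf 𝕋` of the `p`-power tower

Topic `NumberTheory/Automorphic`; namespace `Literature.NumberTheory.Automorphic` (grouping
sub-namespace `TwistedQuotient` for the objects of the twisted function model).  Auxiliary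
definitions with bodies (algebra homomorphisms packaging functorialities) and theorems; no named
fact, no instance, no `sorry`.

This file proves, in the GENERIC vocabulary of `CompletedCohomology` (`LevelTower`, `towerCohomology`,
`towerHeckeFamily`, `IsHeckePoint`) and of the twisted function model of the X2-chain
(`TwistedQuotientIntegralFunctions`, `…IndFunReduction`, `…InducedInvariants`,
`…LevelChangeNilpotent`, `…IntFunHeckeReduction`), the INTEGRAL CONTINUITY STEP of
[Scholze2015, §V.4, proofs of Thm. V.4.1 and Cor. V.4.2] / [Emerton2006, §2.2–2.3]:

  **`TwistedQuotient.isHeckePoint_of_intFun_eigenclass`** — let `ι : Γ → 𝒢`, `T` a tower of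
  levels of `𝒢`, `π` a representation of `𝒢` on a `k`-module `V` without `p`-torsion, `L ≤ 𝒢` a
  level and `M ⊂ V` a FREE `k`-lattice of finite rank stable under `π(L)`, `δ : J → 𝒢` Hecke
  elements with `π(δ j) = 1`; assume that for every `t'` some level `T.level r ≤ L` of the tower is
  normal in `L`, acts trivially on `M/p^{t'} M`, and is HECKE-COMPATIBLE with `L` for the `δ j`
  (`l δⱼ l⁻¹ ∈ L_r δⱼ L_r` for `l ∈ L`; `L_r δⱼ L_r / L_r → L δⱼ L / L` bijective; both finite).
  If `c ∈ H^q(Γ, M̃)` (`M̃ = intFun ι L π M`, the integral twisted functions of level `L`) is a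
  simultaneous eigenclass of the `[L δⱼ L]` with eigenvalues `χ j ∈ k`, of `p`-ADIC CONTENT AT MOST
  `m₀` (`p^u c ∉ p^{u+m₀} H^q(Γ, M̃)` for all `u` — for a class coming from characteristic `0`
  this is "bounded denominators"), and `k` has totally ordered divisibility with `p` a
  non-zero-divisor (`k = 𝒪_E`, `𝒪_{ℚ̄_p}`, `ℤ_p`, …), then `χ` is a `k`-valued point of
  `Spf 𝕋(T)` (`IsHeckePoint ι T p δ χ`): for every `t`, `T_{δ j} ↦ χ j` extends to a continuous
  `k`-algebra homomorphism `𝕋 → k/p^t`.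

Printed argument and its formal counterpart.  Fix `t`, put `N = q + 1`, `t' = N t + m₀`, `n = p^{t'}`,
and let `L' = T.level r` be the level attached to `t'`.
1. (reduction) `M̃ ≅ indFun (π|_L on M)` (`intFunIso`), reduce modulo `n` (`indFunMod`), and identify
   `indFun (π|_L mod n)` — `π|_L mod n` being trivial on `L'` — with the `L/L'`-invariants
   `W^{L/L'}` of `W = Fun(𝒢 ⧸ L', M/n)` (`indFunIsoInvariants`); the composite `red` is Hecke
   equivariant (`heckeIndHom_comp_indFunMod_comp`), so `red c` is an eigenclass in `H^q(Γ, W^{L/L'})`.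
2. (Bockstein) `ker red = n · H^q(Γ, M̃)` (`exists_eq_nsmul_of_map_indFunMod_eq_zero`), hence by the
   content bound and the totality of divisibility the annihilator of `red c` lies in `(p^{t'-m₀})`.
3. (Hochschild–Serre) an abstract Hecke operator `P ∈ k⟨J⟩` acting as `0` on the pieces
   `H^b(X_{L'}, k/p^{t'})`, `b ≤ q`, of the tower acts as `0` on `H^b(Γ, Fun(𝒢 ⧸ L', M/n))`
   (`M/n ≅ (k/p^{t'})^d` and `H^b(X_{L'}, -)` is additive, `cohomologyPiEquiv`), hence with
   `(q+1)`-st power `0` on `H^q(Γ, W^{L/L'})` (`pow_succ_map_φZ_levelProdTwist_eq_zero`).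
4. (bookkeeping) `isHeckePoint_of_nilpotentControl`: `P(χ)^{q+1} ∈ (p^{t'-m₀}) = (p^{(q+1)t})`,
   so `P(χ) ∈ (p^t)`.

Consumers: `bianchi_regularAlgebraicCuspidal_isHeckePoint` (tower `U₀ ∩ K((p)^r)` of `GL₂` over
an imaginary quadratic field, `k = 𝒪_{ℚ̄_p}`), and any discharge of
`algebraicWeightEigenclass_continuousPoint`-type statements phrased with `IsHeckePoint`.
What is NOT here: the construction of the integral eigenclass `c` from a characteristic-`0`
eigenclass (bounded denominators: Borel–Serre finiteness) and the verification of the level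
hypotheses for a specific tower.

## References

* P. Scholze, *On torsion in the cohomology of locally symmetric varieties*, Ann. of Math. 182
  (2015), §V.4, proofs of Thm. V.4.1 and Cor. V.4.2 [Scholze2015].
* M. Emerton, *On the interpolation of systems of eigenvalues attached to automorphic Hecke
  eigenforms*, Invent. Math. 164 (2006), §2.2–2.3 [Emerton2006].
* F. Calegari, M. Emerton, *Completed cohomology — a survey* (2012), §8 [CalegariEmerton2011].
-/

noncomputable section

open CategoryTheory groupCohomology Literature.Algebra.Homology

universe u v


namespace Literature.NumberTheory.Automorphic

/-! ### Linearity of `Hⁿ(Γ, -)` in the morphism, and the induced algebra homomorphisms -/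

namespace IntegralEigenclass

section Linear

variable {k : Type u} [CommRing k] {Γ : Type u} [Group Γ]

/-- `Hⁿ(Γ, φ + ψ) = Hⁿ(Γ, φ) + Hⁿ(Γ, ψ)`. [folklore] -/
theorem groupCohomology_map_id_add {A B : Rep k Γ} (φ ψ : A ⟶ B) (n : ℕ) :
    groupCohomology.map (MonoidHom.id Γ) (φ + ψ) n =
      groupCohomology.map (MonoidHom.id Γ) φ n + groupCohomology.map (MonoidHom.id Γ) ψ n := by
  have h := HomologicalComplex.homologyMap_add (cochainsMap (MonoidHom.id Γ) φ)
    (cochainsMap (MonoidHom.id Γ) ψ) n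
  have hF : cochainsMap (MonoidHom.id Γ) φ + cochainsMap (MonoidHom.id Γ) ψ =
      cochainsMap (MonoidHom.id Γ) (φ + ψ) :=
    ((groupCohomology.cochainsFunctor k Γ).map_add).symm
  rw [hF] at h
  exact h

/-- On inhomogeneous cochains, `r • φ` induces `r •` the map of `φ` (cf. the lemma of
`ModPHeckeEigensystemGL`, outside this file's import cone). [folklore] -/
theorem cochainsMap_id_smul {A B : Rep k Γ} (r : k) (φ : A ⟶ B) :
    cochainsMap (MonoidHom.id Γ) (r • φ) = r • cochainsMap (MonoidHom.id Γ) φ := by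
  refine HomologicalComplex.hom_ext _ _ fun i => ?_
  rw [HomologicalComplex.smul_f_apply]
  refine ModuleCat.hom_ext (LinearMap.ext fun x => funext fun g => ?_)
  rw [ModuleCat.hom_smul]
  rfl

/-- `Hⁿ(Γ, r • φ) = r • Hⁿ(Γ, φ)` (cf. `groupCohomology_map_id_smul` of
`ModPHeckeEigensystemGL`, outside this file's import cone). [folklore] -/
theorem groupCohomology_map_id_smul {A B : Rep k Γ} (r : k) (φ : A ⟶ B) (n : ℕ) :
    groupCohomology.map (MonoidHom.id Γ) (r • φ) n = r • groupCohomology.map (MonoidHom.id Γ) φ n := by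
  rw [groupCohomology.map, groupCohomology.map, cochainsMap_id_smul]
  change ShortComplex.homologyMap ((HomologicalComplex.shortComplexFunctor _ _ n).map
      (r • cochainsMap (MonoidHom.id Γ) φ)) =
    r • ShortComplex.homologyMap ((HomologicalComplex.shortComplexFunctor _ _ n).map
      (cochainsMap (MonoidHom.id Γ) φ))
  rw [← ShortComplex.homologyMap_smul]
  congr 1

/-- `Hⁿ(Γ, 0) = 0`. [folklore] -/
theorem groupCohomology_map_id_zero {A B : Rep k Γ} (n : ℕ) :
    groupCohomology.map (MonoidHom.id Γ) (0 : A ⟶ B) n = 0 := by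
  have h := HomologicalComplex.homologyMap_zero (inhomogeneousCochains A) (inhomogeneousCochains B) n
  rw [← cochainsMap_zero (f := MonoidHom.id Γ)] at h
  exact h

/-- `Hⁿ(Γ, e⁻¹) ∘ Hⁿ(Γ, e) = id` for an isomorphism `e`. [folklore] -/
theorem groupCohomology_map_inv_map_hom_apply {A B : Rep k Γ} (e : A ≅ B) (n : ℕ)
    (z : groupCohomology A n) :
    (groupCohomology.map (MonoidHom.id Γ) e.inv n).hom
      ((groupCohomology.map (MonoidHom.id Γ) e.hom n).hom z) = z := by
  rw [← LinearMap.comp_apply, ← ModuleCat.hom_comp, ← groupCohomology.map_id_comp,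
    e.hom_inv_id, groupCohomology.map_id]
  rfl

/-- `Hⁿ(Γ, e)` is injective for an isomorphism `e`. [folklore] -/
theorem groupCohomology_map_hom_injective_of_iso {A B : Rep k Γ} (e : A ≅ B) (n : ℕ) :
    Function.Injective (groupCohomology.map (MonoidHom.id Γ) e.hom n).hom := by
  intro x y hxy
  rw [← groupCohomology_map_inv_map_hom_apply e n x,
    ← groupCohomology_map_inv_map_hom_apply e n y, hxy]

/-- **`φ ↦ Hⁿ(Γ, φ)` as a `k`-algebra homomorphism `End(X) → End_k Hⁿ(Γ, X)`** (Mathlib's `End X`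
multiplies by `φ * ψ = ψ ≫ φ`, matching composition of the induced linear maps). [folklore] -/
def cohomologyMapAlgHom (X : Rep k Γ) (n : ℕ) : End X →ₐ[k] Module.End k (groupCohomology X n) where
  toFun φ := (groupCohomology.map (MonoidHom.id Γ) φ n).hom
  map_one' := by
    change (groupCohomology.map (MonoidHom.id Γ) (𝟙 X) n).hom = _
    rw [groupCohomology.map_id]
    rfl
  map_mul' φ ψ := by
    change (groupCohomology.map (MonoidHom.id Γ) (ψ ≫ φ) n).hom = _
    rw [groupCohomology.map_id_comp]
    rfl
  map_zero' := by
    have h := congrArg ModuleCat.Hom.hom (groupCohomology_map_id_zero (A := X) (B := X) n)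
    rw [ModuleCat.hom_zero] at h
    exact h
  map_add' φ ψ := by
    have h := congrArg ModuleCat.Hom.hom (groupCohomology_map_id_add (A := X) (B := X) φ ψ n)
    rw [ModuleCat.hom_add] at h
    exact h
  commutes' r := by
    have h := congrArg ModuleCat.Hom.hom (groupCohomology_map_id_smul r (𝟙 X) n)
    rw [groupCohomology.map_id, ModuleCat.hom_smul, ModuleCat.hom_id] at h
    rw [Algebra.algebraMap_eq_smul_one, Algebra.algebraMap_eq_smul_one]
    exact h

/-- Unfolding lemma for `cohomologyMapAlgHom`. [folklore] -/
@[simp]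
theorem cohomologyMapAlgHom_apply (X : Rep k Γ) (n : ℕ) (φ : End X) :
    cohomologyMapAlgHom X n φ = (groupCohomology.map (MonoidHom.id Γ) φ n).hom :=
  rfl

/-- Evaluating free-algebra polynomials through an algebra homomorphism matching the generators.
[folklore] -/
theorem algHom_freeAlgebra_lift {J : Type v} {A B : Type*} [Semiring A] [Semiring B] [Algebra k A]
    [Algebra k B] (Θ : A →ₐ[k] B) (f : J → A) (g : J → B) (h : ∀ j, Θ (f j) = g j)
    (P : FreeAlgebra k J) : Θ (FreeAlgebra.lift k f P) = FreeAlgebra.lift k g P := by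
  change (Θ.comp (FreeAlgebra.lift k f)) P = FreeAlgebra.lift k g P
  congr 1
  refine FreeAlgebra.hom_ext (funext fun j => ?_)
  simp only [Function.comp_apply, AlgHom.comp_apply, FreeAlgebra.lift_ι_apply, h j]

end Linear

end IntegralEigenclass

end Literature.NumberTheory.Automorphic

open Literature.NumberTheory.Automorphic.IntegralEigenclass

namespace Literature.Algebra.Homology

/-! ### Functoriality of `φ ↦ φZ` (the endomorphism induced on `ker dᵃ ⊆ Cᵃ(H, W)`) -/

section PhiZ

universe w

variable {k : Type w} [CommRing k] {Γ H : Type w} [Group Γ] [Group H] (W : Rep.{w} k (Γ × H))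

/-- `φZ` of a composite. [folklore] -/
theorem φZ_comp (φ ψ : W ⟶ W) (a : ℕ) : φZ W (φ ≫ ψ) a = φZ W φ a ≫ φZ W ψ a :=
  Rep.hom_ext (Representation.IntertwiningMap.ext (LinearMap.ext fun _ => rfl))

/-- `φZ` of the identity. [folklore] -/
theorem φZ_id (a : ℕ) : φZ W (𝟙 W) a = 𝟙 _ :=
  Rep.hom_ext (Representation.IntertwiningMap.ext (LinearMap.ext fun _ => rfl))

/-- `φZ` is additive. [folklore] -/
theorem φZ_add (φ ψ : W ⟶ W) (a : ℕ) : φZ W (φ + ψ) a = φZ W φ a + φZ W ψ a :=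
  Rep.hom_ext (Representation.IntertwiningMap.ext (LinearMap.ext fun _ => rfl))

/-- `φZ` of zero. [folklore] -/
theorem φZ_zero (a : ℕ) : φZ W (0 : W ⟶ W) a = 0 :=
  Rep.hom_ext (Representation.IntertwiningMap.ext (LinearMap.ext fun _ => rfl))

/-- `φZ` is `k`-linear. [folklore] -/
theorem φZ_smul (r : k) (φ : W ⟶ W) (a : ℕ) : φZ W (r • φ) a = r • φZ W φ a :=
  Rep.hom_ext (Representation.IntertwiningMap.ext (LinearMap.ext fun _ => rfl))

/-- **`φ ↦ φZ φ` as a `k`-algebra homomorphism `End(W) → End(ker dᵃ)`.** [folklore] -/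
def φZAlgHom (a : ℕ) : End W →ₐ[k] End (hKerRep W a) where
  toFun φ := φZ W φ a
  map_one' := φZ_id W a
  map_mul' φ ψ := by
    change φZ W (ψ ≫ φ) a = φZ W ψ a ≫ φZ W φ a
    exact φZ_comp W ψ φ a
  map_zero' := φZ_zero W a
  map_add' φ ψ := φZ_add W φ ψ a
  commutes' r := by
    rw [Algebra.algebraMap_eq_smul_one, Algebra.algebraMap_eq_smul_one]
    exact Rep.hom_ext (Representation.IntertwiningMap.ext (LinearMap.ext fun _ => rfl))

/-- Unfolding lemma for `φZAlgHom`. [folklore] -/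
@[simp]
theorem φZAlgHom_apply (a : ℕ) (φ : End W) : φZAlgHom W a φ = φZ W φ a :=
  rfl

end PhiZ

end Literature.Algebra.Homology

namespace Literature.NumberTheory.Automorphic

/-! ### Free lattices of finite rank: `M/IM ≅ (k/I)^d` -/

section FreeQuot

variable {k : Type u} [CommRing k]

/-- `I • k^d = I^d` inside `k^d`. [folklore] -/
theorem ideal_smul_top_eq_pi (I : Ideal k) (d : ℕ) :
    (I • (⊤ : Submodule k (Fin d → k))) =
      Submodule.pi Set.univ (fun _ : Fin d => (I : Submodule k k)) := by
  refine le_antisymm ?_ ?_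
  · refine Submodule.smul_le.2 fun r hr x _ => ?_
    refine (Submodule.mem_pi).2 fun i _ => ?_
    change r * x i ∈ I
    exact I.mul_mem_right _ hr
  · intro x hx
    rw [Submodule.mem_pi] at hx
    have hxsum : x = ∑ i, x i • (Pi.single i 1 : Fin d → k) := by
      conv_lhs => rw [← Finset.univ_sum_single x]
      refine Finset.sum_congr rfl fun i _ => ?_
      rw [← Pi.single_smul, smul_eq_mul, mul_one]
    rw [hxsum]
    exact Submodule.sum_mem _ fun i _ =>
      Submodule.smul_mem_smul (hx i (Set.mem_univ i)) Submodule.mem_top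

variable {M₀ : Type u} [AddCommGroup M₀] [Module k M₀]

/-- **`M/IM ≅ (k/I)^d` for a free `k`-module `M ≅ k^d` of finite rank.** [folklore] -/
def quotSMulTopEquivPi {d : ℕ} (e : M₀ ≃ₗ[k] (Fin d → k)) (I : Ideal k) :
    (M₀ ⧸ (I • (⊤ : Submodule k M₀))) ≃ₗ[k] (Fin d → k ⧸ I) :=
  (Submodule.Quotient.equiv (I • ⊤) (I • ⊤) e (by
      rw [Submodule.map_smul'', Submodule.map_top, LinearEquiv.range])).trans
    ((Submodule.quotEquivOfEq _ _ (ideal_smul_top_eq_pi I d)).trans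
      (Submodule.quotientPi fun _ : Fin d => (I : Submodule k k)))

end FreeQuot

/-! ### The diagonal algebra homomorphism `End(X) → End(X^I)` -/

section Diag

variable (k : Type u) [CommRing k] (X : Type*) [AddCommGroup X] [Module k X] (I : Type*)

/-- `f ↦ (f ∘ -)`, the diagonal action of `End X` on `I → X`, as a `k`-algebra homomorphism.
[folklore] -/
def diagAlgHom : Module.End k X →ₐ[k] Module.End k (I → X) where
  toFun f := f.compLeft I
  map_one' := rfl
  map_mul' _ _ := rfl
  map_zero' := rfl
  map_add' _ _ := rfl
  commutes' r := by
    rw [Algebra.algebraMap_eq_smul_one, Algebra.algebraMap_eq_smul_one]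
    rfl

/-- Unfolding lemma for `diagAlgHom`. [folklore] -/
@[simp]
theorem diagAlgHom_apply_apply (f : Module.End k X) (y : I → X) (i : I) :
    diagAlgHom k X I f y i = f (y i) :=
  rfl

end Diag

/-! ### Transport of the vanishing of abstract Hecke operators (untwisted model) -/

namespace ArithmeticQuotient

variable {k : Type u} [CommRing k] {Γ 𝒢 : Type u} [Group Γ] [Group 𝒢] (ι : Γ →* 𝒢)
  (L : Subgroup 𝒢) {M M' : Type u} [AddCommGroup M] [Module k M] [AddCommGroup M'] [Module k M']
  {J : Type v}

/-- The isomorphism of coefficient representations `Fun(𝒢 ⧸ L, M) ≅ Fun(𝒢 ⧸ L, M')` induced by a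
`k`-linear isomorphism `M ≃ M'`. [folklore] -/
def coeffIso (e : M ≃ₗ[k] M') : coeffRep k ι L M ≅ coeffRep k ι L M' where
  hom := coeffHom ι L e.toLinearMap
  inv := coeffHom ι L e.symm.toLinearMap
  hom_inv_id := Rep.hom_ext (Representation.IntertwiningMap.ext (LinearMap.ext fun f =>
    funext fun c => e.symm_apply_apply (f c)))
  inv_hom_id := Rep.hom_ext (Representation.IntertwiningMap.ext (LinearMap.ext fun f =>
    funext fun c => e.apply_symm_apply (f c)))

/-- `H^i(X_L, M) ≃ H^i(X_L, M')` along `M ≃ M'`. [folklore] -/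
def cohomologyCoeffEquiv (e : M ≃ₗ[k] M') (i : ℕ) : cohomology k ι L M i ≃ₗ[k] cohomology k ι L M' i :=
  ((groupCohomology.functor k Γ i).mapIso (coeffIso ι L e)).toLinearEquiv

/-- Unfolding lemma for `cohomologyCoeffEquiv`. [folklore] -/
theorem cohomologyCoeffEquiv_apply (e : M ≃ₗ[k] M') (i : ℕ) (x : cohomology k ι L M i) :
    cohomologyCoeffEquiv ι L e i x = (cohomologyCoeffMap ι L e.toLinearMap i).hom x :=
  rfl

/-- `cohomologyCoeffEquiv` commutes with the Hecke operators. [folklore] -/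
theorem cohomologyCoeffEquiv_heckeEnd (e : M ≃ₗ[k] M') (g : 𝒢) (i : ℕ) (x : cohomology k ι L M i) :
    cohomologyCoeffEquiv ι L e i (heckeEnd k L g M ι i x) =
      heckeEnd k L g M' ι i (cohomologyCoeffEquiv ι L e i x) := by
  have h := congrArg (fun f => (ModuleCat.Hom.hom f) x)
    (heckeOperator_comp_cohomologyCoeffMap L g ι e.toLinearMap i)
  simp only [ModuleCat.hom_comp, LinearMap.comp_apply] at h
  rw [cohomologyCoeffEquiv_apply, cohomologyCoeffEquiv_apply]
  exact h

/-- **Abstract Hecke operators vanishing on `H^i(X_L, M)` vanish on `H^i(X_L, M')` for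
`M' ≅ M`.** [folklore] -/
theorem freeAlgebra_lift_heckeEnd_eq_zero_of_equiv (e : M ≃ₗ[k] M') (δ : J → 𝒢) (i : ℕ)
    (P : FreeAlgebra k J) (hP : FreeAlgebra.lift k (fun j => heckeEnd k L (δ j) M ι i) P = 0) :
    FreeAlgebra.lift k (fun j => heckeEnd k L (δ j) M' ι i) P = 0 := by
  have key : FreeAlgebra.lift k (fun j => heckeEnd k L (δ j) M' ι i) P =
      ((cohomologyCoeffEquiv ι L e i).conjAlgEquiv k : _ →ₐ[k] _)
        (FreeAlgebra.lift k (fun j => heckeEnd k L (δ j) M ι i) P) := by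
    refine (algHom_freeAlgebra_lift _ _ _ (fun j => LinearMap.ext fun y => ?_) P).symm
    change (cohomologyCoeffEquiv ι L e i).conjAlgEquiv k (heckeEnd k L (δ j) M ι i) y = _
    rw [LinearEquiv.conjAlgEquiv_apply, LinearMap.comp_apply, LinearMap.comp_apply,
      LinearEquiv.coe_toLinearMap, LinearEquiv.coe_toLinearMap, cohomologyCoeffEquiv_heckeEnd,
      LinearEquiv.apply_symm_apply]
  rw [key, hP, map_zero]

/-- **Abstract Hecke operators vanishing on `H^i(X_L, M)` vanish on `H^i(X_L, M^d)`**
(`H^i(X_L, -)` is additive and Hecke operators act coordinatewise, `cohomologyPiEquiv`).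
[folklore] -/
theorem freeAlgebra_lift_heckeEnd_pi_eq_zero {I : Type u} [Fintype I] [DecidableEq I] (δ : J → 𝒢)
    (i : ℕ) (P : FreeAlgebra k J)
    (hP : FreeAlgebra.lift k (fun j => heckeEnd k L (δ j) M ι i) P = 0) :
    FreeAlgebra.lift k (fun j => heckeEnd k L (δ j) (I → M) ι i) P = 0 := by
  let eπ := cohomologyPiEquiv k ι L i M (J := I)
  have key : FreeAlgebra.lift k (fun j => heckeEnd k L (δ j) (I → M) ι i) P =
      (eπ.symm.conjAlgEquiv k : _ →ₐ[k] _)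
        (diagAlgHom k _ I (FreeAlgebra.lift k (fun j => heckeEnd k L (δ j) M ι i) P)) := by
    rw [algHom_freeAlgebra_lift (diagAlgHom k _ I) (fun j => heckeEnd k L (δ j) M ι i)
      (fun j => diagAlgHom k _ I (heckeEnd k L (δ j) M ι i)) (fun j => rfl) P]
    refine (algHom_freeAlgebra_lift _ _ _ (fun j => LinearMap.ext fun y => ?_) P).symm
    change eπ.symm.conjAlgEquiv k (diagAlgHom k _ I (heckeEnd k L (δ j) M ι i)) y = _
    rw [LinearEquiv.conjAlgEquiv_apply, LinearMap.comp_apply, LinearMap.comp_apply,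
      LinearEquiv.coe_toLinearMap, LinearEquiv.coe_toLinearMap, LinearEquiv.symm_symm]
    apply eπ.injective
    rw [LinearEquiv.apply_symm_apply]
    funext j'
    rw [diagAlgHom_apply_apply, cohomologyPiEquiv_heckeEnd]
  rw [key, hP, map_zero, map_zero]

end ArithmeticQuotient

namespace TwistedQuotient

variable {k : Type u} [CommRing k] {Γ 𝒢 : Type u} [Group Γ] [Group 𝒢] (ι : Γ →* 𝒢) {J : Type v}

/-- **Transport to the twisted model with trivial twist**: abstract Hecke operators vanishing on
`H^i(X_L, N)` (untwisted model) vanish on `H^i(Γ, Fun(𝒢 ⧸ L, N)_1)` (twisted model, `ρ = 1`),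
along `ArithmeticQuotient.coeffRepIsoTwisted`. [folklore] -/
theorem freeAlgebra_lift_heckeEnd_one_eq_zero (L : Subgroup 𝒢) (N : Type u) [AddCommGroup N]
    [Module k N] (δ : J → 𝒢) (i : ℕ) (P : FreeAlgebra k J)
    (hP : FreeAlgebra.lift k (fun j => ArithmeticQuotient.heckeEnd k L (δ j) N ι i) P = 0) :
    FreeAlgebra.lift k (fun j => heckeEnd ι L (1 : Representation k Γ N) (δ j) i) P = 0 := by
  let e₁ : ArithmeticQuotient.cohomology k ι L N i ≃ₗ[k] cohomology ι L (1 : Representation k Γ N) i :=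
    ((groupCohomology.functor k Γ i).mapIso (ArithmeticQuotient.coeffRepIsoTwisted k ι L N)).toLinearEquiv
  have he₁ : ∀ (g : 𝒢) (x : ArithmeticQuotient.cohomology k ι L N i),
      e₁ (ArithmeticQuotient.heckeEnd k L g N ι i x) = heckeEnd ι L (1 : Representation k Γ N) g i (e₁ x) :=
    fun g x => ArithmeticQuotient.map_coeffRepIsoTwisted_heckeEnd k ι L N g i x
  have key : FreeAlgebra.lift k (fun j => heckeEnd ι L (1 : Representation k Γ N) (δ j) i) P =
      (e₁.conjAlgEquiv k : _ →ₐ[k] _)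
        (FreeAlgebra.lift k (fun j => ArithmeticQuotient.heckeEnd k L (δ j) N ι i) P) := by
    refine (algHom_freeAlgebra_lift _ _ _ (fun j => LinearMap.ext fun y => ?_) P).symm
    change e₁.conjAlgEquiv k (ArithmeticQuotient.heckeEnd k L (δ j) N ι i) y = _
    rw [LinearEquiv.conjAlgEquiv_apply, LinearMap.comp_apply, LinearMap.comp_apply,
      LinearEquiv.coe_toLinearMap, LinearEquiv.coe_toLinearMap, he₁, LinearEquiv.apply_symm_apply]
  rw [key, hP, map_zero]

/-! ### `toLevelTwist'` as an algebra homomorphism -/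

section ToLevel

variable {L' L : Subgroup 𝒢} (hle : L' ≤ L) [hN : (L'.subgroupOf L).Normal]
  {V : Type u} [AddCommGroup V] [Module k V] (ρ : Representation k Γ V)
  (σ : Representation k (L ⧸ L'.subgroupOf L) V)
  (hc : ∀ (γ : Γ) (h : L ⧸ L'.subgroupOf L), Commute (ρ γ) (σ h))

/-- **`φ' ↦ toLevelTwist' φ'` as a `k`-algebra homomorphism `End(W) → End(Fun(𝒢 ⧸ L', V))`.**
[folklore] -/
def toLevelTwist'AlgHom : End (levelProdTwist ι hle ρ σ hc) →ₐ[k] End (coeffRep ι L' ρ) where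
  toFun := toLevelTwist' ι hle ρ σ hc
  map_one' := (toLevelTwist'RingHom ι hle ρ σ hc).map_one
  map_mul' := (toLevelTwist'RingHom ι hle ρ σ hc).map_mul
  map_zero' := (toLevelTwist'RingHom ι hle ρ σ hc).map_zero
  map_add' := (toLevelTwist'RingHom ι hle ρ σ hc).map_add
  commutes' r := by
    rw [Algebra.algebraMap_eq_smul_one, Algebra.algebraMap_eq_smul_one]
    exact Rep.hom_ext (Representation.IntertwiningMap.ext (LinearMap.ext fun _ => rfl))

/-- Unfolding lemma for `toLevelTwist'AlgHom`. [folklore] -/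
@[simp]
theorem toLevelTwist'AlgHom_apply (φ' : End (levelProdTwist ι hle ρ σ hc)) :
    toLevelTwist'AlgHom ι hle ρ σ hc φ' = toLevelTwist' ι hle ρ σ hc φ' :=
  rfl

end ToLevel

end TwistedQuotient

end Literature.NumberTheory.Automorphic

namespace Literature.NumberTheory.Automorphic

/-! ### Divisibility bookkeeping in rings with totally ordered divisibility -/

section Divisibility

variable {k : Type u} [CommRing k]

/-- In a ring whose divisibility is total (a valuation ring) and for a non-zero-divisor `ϖ`:
`a^N ∈ (ϖ^{N t})`, `N ≠ 0` ⟹ `a ∈ (ϖ^t)`. [folklore] -/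
theorem mem_span_pow_of_pow_mem_span_pow_mul (htot : ∀ a b : k, a ∣ b ∨ b ∣ a) {ϖ : k}
    (hreg : IsLeftRegular ϖ) {N t : ℕ} (hN : N ≠ 0) {a : k}
    (h : a ^ N ∈ Ideal.span {ϖ ^ (N * t)}) : a ∈ Ideal.span {ϖ ^ t} := by
  rw [Ideal.mem_span_singleton] at h ⊢
  rcases htot (ϖ ^ t) a with hdvd | ⟨b, hb⟩
  · exact hdvd
  · -- `ϖ^t = a b`, `a^N = ϖ^{Nt} c'` ⟹ `1 = c' b^N` ⟹ `b` is a unit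
    obtain ⟨c', hc'⟩ := h
    have key : ϖ ^ (N * t) * 1 = ϖ ^ (N * t) * (c' * b ^ N) := by
      calc ϖ ^ (N * t) * 1 = (ϖ ^ t) ^ N := by rw [mul_one, ← pow_mul, mul_comm]
        _ = a ^ N * b ^ N := by rw [hb, mul_pow]
        _ = ϖ ^ (N * t) * (c' * b ^ N) := by rw [hc', mul_assoc]
    have h1 : (1 : k) = c' * b ^ N := (hreg.pow (N * t)) key
    have hbu : IsUnit b :=
      isUnit_of_dvd_one ((dvd_pow_self b hN).trans (Dvd.intro_left _ h1.symm))
    refine ⟨(hbu.unit⁻¹ : kˣ), ?_⟩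
    rw [hb, mul_assoc, IsUnit.mul_val_inv, mul_one]

/-- In a ring whose divisibility is total: if `ϖ^s • x ≠ 0` then the annihilator of `x` lies in
`(ϖ^s)`. [folklore] -/
theorem mem_span_pow_of_smul_eq_zero (htot : ∀ a b : k, a ∣ b ∨ b ∣ a) {H : Type*}
    [AddCommGroup H] [Module k H] {ϖ : k} {s : ℕ} {x : H} (hx : ϖ ^ s • x ≠ 0) {a : k}
    (ha : a • x = 0) : a ∈ Ideal.span {ϖ ^ s} := by
  rw [Ideal.mem_span_singleton]
  rcases htot (ϖ ^ s) a with hdvd | ⟨b, hb⟩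
  · exact hdvd
  · exact absurd (by rw [hb, mul_comm, mul_smul, ha, smul_zero]) hx

end Divisibility

namespace TwistedQuotient

variable {k : Type u} [CommRing k] {Γ 𝒢 : Type u} [Group Γ] [Group 𝒢] (ι : Γ →* 𝒢)

/-! ### The reduction `M̃ → W^{L/L'}` and its properties -/

section Reduction

variable {L' L : Subgroup 𝒢} (hle : L' ≤ L) [hN : (L'.subgroupOf L).Normal]
  {V : Type u} [AddCommGroup V] [Module k V] (π : Representation k 𝒢 V)
  (M : Submodule k V) (hM : ∀ l ∈ L, ∀ m ∈ M, π l m ∈ M) (n : ℕ)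
  (hL' : ModTrivialOn π M hM n L')

/-- `W = Fun(𝒢 ⧸ L', M/n)` as a representation of `Γ × (L ⧸ L')` (`Γ` by left translation,
`L ⧸ L'` by `σ̄`-twisted right translation, `σ̄ = π|_L mod n`, trivial on `L'`): the object of
`TwistedQuotientInducedInvariants` for the reduced lattice representation. [folklore] -/
abbrev modLevelProd : Rep k (Γ × (L ⧸ L'.subgroupOf L)) :=
  inducedLevelProd ι hle (modRep L (latticeRep L π M hM) n) (modRep_eq_one_of_modTrivialOn π M hM n hL')

/-- `W^{L/L'}` as a representation of `Γ`. [folklore] -/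
abbrev modInvariants : Rep k Γ :=
  hKerRep (modLevelProd ι hle π M hM n hL') 0

omit hN in
variable {hle π hM hL'} in
/-- The coefficient module `M/n` of `W`. [folklore] -/
abbrev ModCoeff : Type u :=
  M ⧸ nsmulSubmodule (A := k) (N := M) n

variable {hle π M hM n hL'} in
/-- The Hecke operator `[L' t L']` on `W` (`heckeProdTwistHom` for `ρ = 1`, `σ = σ̄`). [folklore] -/
abbrev modHecke {t : 𝒢}
    (hconj : ∀ l : L, ∃ a ∈ L', ∃ b ∈ L', (l : 𝒢) * t * (l : 𝒢)⁻¹ = a * t * b)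
    (hfin' : (ArithmeticQuotient.doubleCosetQuot L' t).Finite) :
    End (modLevelProd ι hle π M hM n hL') :=
  heckeProdTwistHom ι hle (1 : Representation k Γ (ModCoeff M n))
    (quotRep (modRep L (latticeRep L π M hM) n) (modRep_eq_one_of_modTrivialOn π M hM n hL'))
    (commute_one_quotRep _ _) hconj hfin'

/-- **The reduction map `red : M̃ → W^{L/L'}`**, `W = Fun(𝒢 ⧸ L', M/n)`: untwist
(`intFunIso`), reduce modulo `n` (`indFunMod`), descend to the invariants (`indFunIsoInvariants`).
[cite: Scholze2015, §V.4, proof of Thm. V.4.1] -/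
def redHom : intFun ι L π M ⟶ modInvariants ι hle π M hM n hL' :=
  (intFunIso ι L π M hM).hom ≫ indFunMod ι L (latticeRep L π M hM) n ≫
    (indFunIsoInvariants ι hle (modRep L (latticeRep L π M hM) n)
      (modRep_eq_one_of_modTrivialOn π M hM n hL')).hom

/-- `red` on `H^q`. [folklore] -/
abbrev redMap (q : ℕ) : groupCohomology (intFun ι L π M) q →ₗ[k]
    groupCohomology (modInvariants ι hle π M hM n hL') q :=
  (groupCohomology.map (MonoidHom.id Γ) (A := intFun ι L π M)
    (B := modInvariants ι hle π M hM n hL') (redHom ι hle π M hM n hL') q).hom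

variable {t : 𝒢} (ht : π t = 1)
  (hconj : ∀ l : L, ∃ a ∈ L', ∃ b ∈ L', (l : 𝒢) * t * (l : 𝒢)⁻¹ = a * t * b)

/-- **`red` intertwines `[L t L]` on `M̃` with `[L' t L']` on `W^{L/L'}`** (morphism form).
[cite: Scholze2015, §V.4, proof of Thm. V.4.1] -/
theorem heckeIntHom_comp_redHom
    (hbij : Set.BijOn (Subgroup.quotientMapOfLE hle) (ArithmeticQuotient.doubleCosetQuot L' t)
      (ArithmeticQuotient.doubleCosetQuot L t))
    (hfin : (ArithmeticQuotient.doubleCosetQuot L t).Finite)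
    (hfin' : (ArithmeticQuotient.doubleCosetQuot L' t).Finite) :
    heckeIntHom ι L π M hM (rep_mem_of_eq_one π M ht) ≫ redHom ι hle π M hM n hL' =
      redHom ι hle π M hM n hL' ≫
        φZ (modLevelProd ι hle π M hM n hL') (modHecke ι hconj hfin') 0 := by
  rw [redHom, ← Category.assoc, ← intFunIso_hom_comp_heckeIndHom, Category.assoc,
    heckeIndHom_comp_indFunMod_comp ι hle π M hM n ht hconj hL' hbij hfin hfin']
  simp only [Category.assoc]

/-- The same on `H^q`: `T_{L'} (red x) = red (T_L x)`. [folklore] -/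
theorem map_φZ_redMap
    (hbij : Set.BijOn (Subgroup.quotientMapOfLE hle) (ArithmeticQuotient.doubleCosetQuot L' t)
      (ArithmeticQuotient.doubleCosetQuot L t))
    (hfin : (ArithmeticQuotient.doubleCosetQuot L t).Finite)
    (hfin' : (ArithmeticQuotient.doubleCosetQuot L' t).Finite) (q : ℕ)
    (x : groupCohomology (intFun ι L π M) q) :
    (groupCohomology.map (MonoidHom.id Γ) (A := modInvariants ι hle π M hM n hL')
        (B := modInvariants ι hle π M hM n hL')
        (φZ (modLevelProd ι hle π M hM n hL') (modHecke ι hconj hfin') 0) q).hom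
        (redMap ι hle π M hM n hL' q x) =
      redMap ι hle π M hM n hL' q
        ((groupCohomology.map (MonoidHom.id Γ) (A := intFun ι L π M) (B := intFun ι L π M)
          (heckeIntHom ι L π M hM (rep_mem_of_eq_one π M ht)) q).hom x) := by
  have h := congrArg (fun f => (groupCohomology.map (MonoidHom.id Γ) (A := intFun ι L π M)
    (B := modInvariants ι hle π M hM n hL') f q).hom x)
    (heckeIntHom_comp_redHom ι hle π M hM n hL' ht hconj hbij hfin hfin')
  simp only [groupCohomology.map_id_comp, ModuleCat.hom_comp, LinearMap.comp_apply] at h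
  exact h.symm

omit hN in
/-- **Bockstein for `red`**: a class killed by `red` is divisible by `n` (the outer maps are
isomorphisms, the middle one has kernel `n · H^q` by `exists_eq_nsmul_of_map_indFunMod_eq_zero`).
[cite: Scholze2015, §V.4, proof of Thm. V.4.1] -/
theorem exists_eq_smul_of_redMap_eq_zero [hN : (L'.subgroupOf L).Normal]
    (hn : Function.Injective fun x : M => (n : k) • x) (q : ℕ)
    (x : groupCohomology (intFun ι L π M) q) (hx : redMap ι hle π M hM n hL' q x = 0) :
    ∃ y : groupCohomology (intFun ι L π M) q, x = (n : k) • y := by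
  have hinj := groupCohomology_map_hom_injective_of_iso
    (indFunIsoInvariants ι hle (modRep L (latticeRep L π M hM) n)
      (modRep_eq_one_of_modTrivialOn π M hM n hL')) q
  have h1 : (groupCohomology.map (MonoidHom.id Γ) (A := indFun ι L (latticeRep L π M hM))
      (B := indFun ι L (modRep L (latticeRep L π M hM) n)) (indFunMod ι L (latticeRep L π M hM) n) q).hom
      ((groupCohomology.map (MonoidHom.id Γ) (A := intFun ι L π M)
        (B := indFun ι L (latticeRep L π M hM)) (intFunIso ι L π M hM).hom q).hom x) = 0 := by
    apply hinj
    rw [map_zero]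
    rw [redMap, redHom, groupCohomology.map_id_comp, groupCohomology.map_id_comp] at hx
    simpa only [ModuleCat.hom_comp, LinearMap.comp_apply] using hx
  obtain ⟨y₁, hy₁⟩ :=
    exists_eq_nsmul_of_map_indFunMod_eq_zero ι L (latticeRep L π M hM) n hn q _ h1
  refine ⟨(groupCohomology.map (MonoidHom.id Γ) (A := indFun ι L (latticeRep L π M hM))
    (B := intFun ι L π M) (intFunIso ι L π M hM).inv q).hom y₁, ?_⟩
  have hx2 : x = (groupCohomology.map (MonoidHom.id Γ) (A := indFun ι L (latticeRep L π M hM))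
      (B := intFun ι L π M) (intFunIso ι L π M hM).inv q).hom
      ((groupCohomology.map (MonoidHom.id Γ) (A := intFun ι L π M)
        (B := indFun ι L (latticeRep L π M hM)) (intFunIso ι L π M hM).hom q).hom x) :=
    (groupCohomology_map_inv_map_hom_apply (intFunIso ι L π M hM) q x).symm
  rw [hx2, hy₁, map_nsmul, Nat.cast_smul_eq_nsmul]

end Reduction

/-! ### The main theorem -/

section Point

variable (T : LevelTower 𝒢) (p : ℕ) {V : Type u} [AddCommGroup V] [Module k V]
  (π : Representation k 𝒢 V) (L : Subgroup 𝒢) (M : Submodule k V)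
  (hM : ∀ l ∈ L, ∀ m ∈ M, π l m ∈ M) {J : Type v} (δ : J → 𝒢) (χ : J → k)

/-- Multiplication by `p^s` is injective on `M` when `V ⊇ M` has no `p`-torsion. [folklore] -/
theorem pow_smul_injective (hV : ∀ v : V, (p : k) • v = 0 → v = 0) (s : ℕ) :
    Function.Injective fun x : M => ((p ^ s : ℕ) : k) • x := by
  have key : ∀ (s : ℕ) (v : V), (p : k) ^ s • v = 0 → v = 0 := by
    intro s
    induction s with
    | zero => intro v hv; simpa using hv
    | succ s ih =>
      intro v hv
      rw [pow_succ, mul_smul] at hv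
      exact hV _ (ih _ hv)
  intro x y hxy
  have h := congrArg Subtype.val hxy
  simp only [Nat.cast_pow, Submodule.coe_smul] at h
  have h0 : (p : k) ^ s • ((x : V) - y) = 0 := by rw [smul_sub, h, sub_self]
  exact Subtype.ext (sub_eq_zero.1 (key s _ h0))

/-- **Nilpotent control at one torsion level.**  For a level `L' = T.level r ≤ L` of the tower,
normal in `L`, acting trivially on `M/p^{t'}` and Hecke-compatible with `L` for the `δ j`, and an
integral eigenclass `c ∈ H^q(Γ, M̃)` of content `≤ m₀ ≤ t'`: the reduction `red c ∈ H^q(Γ, W^{L/L'})`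
is an eigenclass with annihilator in `(p^{t'-m₀})`, and every abstract Hecke operator vanishing on
the pieces `H^b(X_{L'}, k/p^{t'})`, `b ≤ q`, acts on it with `(q+1)`-st power `0`.
[cite: Scholze2015, §V.4, proofs of Thm. V.4.1 and Cor. V.4.2] -/
theorem nilpotentControl_at_level (htot : ∀ a b : k, a ∣ b ∨ b ∣ a)
    (hV : ∀ v : V, (p : k) • v = 0 → v = 0) {d : ℕ} (e : M ≃ₗ[k] (Fin d → k))
    (hδ : ∀ j, π (δ j) = 1) (hfin : ∀ j, (ArithmeticQuotient.doubleCosetQuot L (δ j)).Finite)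
    (t' r : ℕ) (hle : T.level r ≤ L) [hN : ((T.level r).subgroupOf L).Normal]
    (hmod : ModTrivialOn π M hM (p ^ t') (T.level r))
    (hconj : ∀ (j : J) (l : L), ∃ a ∈ T.level r, ∃ b ∈ T.level r,
      (l : 𝒢) * δ j * (l : 𝒢)⁻¹ = a * δ j * b)
    (hbij : ∀ j, Set.BijOn (Subgroup.quotientMapOfLE hle)
      (ArithmeticQuotient.doubleCosetQuot (T.level r) (δ j))
      (ArithmeticQuotient.doubleCosetQuot L (δ j)))
    (hfin' : ∀ j, (ArithmeticQuotient.doubleCosetQuot (T.level r) (δ j)).Finite)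
    {q : ℕ} (c : groupCohomology (intFun ι L π M) q)
    (heig : ∀ j, (groupCohomology.map (MonoidHom.id Γ) (A := intFun ι L π M) (B := intFun ι L π M)
      (heckeIntHom ι L π M hM (rep_mem_of_eq_one π M (hδ j))) q).hom c = χ j • c)
    {m₀ : ℕ} (hm₀ : m₀ ≤ t') (hcont : ∀ (u : ℕ) (y : groupCohomology (intFun ι L π M) q),
      (p : k) ^ u • c ≠ (p : k) ^ (u + m₀) • y) :
    ∃ (H : Type u) (_ : AddCommGroup H) (_ : Module k H) (S : J → Module.End k H) (c' : H),
      (∀ j, S j c' = χ j • c') ∧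
      (∀ a : k, a • c' = 0 → a ∈ Ideal.span {(p : k) ^ (t' - m₀)}) ∧
      ∀ P : FreeAlgebra k J,
        (∀ b ≤ q, FreeAlgebra.lift k (fun j => towerHeckeFamily k ι T (p : k) (δ j)) P (b, r, t') = 0) →
          (FreeAlgebra.lift k S P ^ (q + 1)) c' = 0 := by
  classical
  -- notation: `W`, its Hecke operators, their action `S` on `H^q(Γ, W^{L/L'})`, the reduction
  let W := modLevelProd ι hle π M hM (p ^ t') hmod
  let hPTH : J → End W := fun j => modHecke ι (hconj j) (hfin' j)
  let S : J → Module.End k (groupCohomology (hKerRep W 0) q) := fun j =>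
    (groupCohomology.map (MonoidHom.id Γ) (A := hKerRep W 0) (B := hKerRep W 0)
      (φZ W (hPTH j) 0) q).hom
  refine ⟨groupCohomology (hKerRep W 0) q, inferInstance, inferInstance, S,
    redMap ι hle π M hM (p ^ t') hmod q c, ?_, ?_, ?_⟩
  · -- eigenclass
    intro j
    change (groupCohomology.map (MonoidHom.id Γ) (A := hKerRep W 0) (B := hKerRep W 0)
        (φZ W (hPTH j) 0) q).hom (redMap ι hle π M hM (p ^ t') hmod q c) =
      χ j • redMap ι hle π M hM (p ^ t') hmod q c
    rw [map_φZ_redMap ι hle π M hM (p ^ t') hmod (hδ j) (hconj j) (hbij j) (hfin j) (hfin' j) q c,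
      heig j, map_smul]
  · -- annihilator
    intro a ha
    refine mem_span_pow_of_smul_eq_zero htot (fun h0 => ?_) ha
    have h0' : redMap ι hle π M hM (p ^ t') hmod q ((p : k) ^ (t' - m₀) • c) = 0 := by
      rw [map_smul]; exact h0
    obtain ⟨y, hy⟩ := exists_eq_smul_of_redMap_eq_zero ι hle π M hM (p ^ t') hmod
      (pow_smul_injective p M hV t') q _ h0'
    refine hcont (t' - m₀) y ?_
    rw [hy, Nat.cast_pow, Nat.sub_add_cancel hm₀]
  · -- nilpotent control
    intro P hP
    let φ'P : End W := FreeAlgebra.lift k hPTH P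
    have hSP : FreeAlgebra.lift k S P =
        (groupCohomology.map (MonoidHom.id Γ) (A := hKerRep W 0) (B := hKerRep W 0)
          (φZ W φ'P 0) q).hom :=
      (algHom_freeAlgebra_lift ((cohomologyMapAlgHom (hKerRep W 0) q).comp (φZAlgHom W 0))
        hPTH S (fun j => rfl) P).symm
    -- the coefficient module `M/p^{t'} ≅ (k/p^{t'})^d`
    have hsub : nsmulSubmodule (A := k) (N := M) (p ^ t') =
        Ideal.span {(p : k) ^ t'} • (⊤ : Submodule k M) := by
      rw [nsmulSubmodule, Nat.cast_pow]
    let eN : ModCoeff M (p ^ t') ≃ₗ[k] (ULift.{u} (Fin d) → modPow k (p : k) t') :=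
      (Submodule.quotEquivOfEq _ _ hsub).trans
        ((quotSMulTopEquivPi e (Ideal.span {(p : k) ^ t'})).trans
          (LinearEquiv.funCongrLeft k (modPow k (p : k) t') Equiv.ulift))
    -- the data of `W` spelled out (for `toLevelTwist'` and the nilpotence theorem)
    have hσn := modRep_eq_one_of_modTrivialOn π M hM (p ^ t') hmod
    let ρ₁ : Representation k Γ (ModCoeff M (p ^ t')) := 1
    let σq := quotRep (modRep L (latticeRep L π M hM) (p ^ t')) hσn
    have hc₁ : ∀ (γ : Γ) (h : L ⧸ (T.level r).subgroupOf L), Commute (ρ₁ γ) (σq h) :=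
      commute_one_quotRep _ _
    let gL' : J → End (coeffRep ι (T.level r) ρ₁) := fun j => heckeRepHom ι (T.level r) ρ₁ (δ j)
    -- the vanishing hypothesis of the Hochschild–Serre nilpotence
    have hφ : ∀ b ≤ q, groupCohomology.map (MonoidHom.id Γ) (A := coeffRep ι (T.level r) ρ₁)
        (B := coeffRep ι (T.level r) ρ₁) (toLevelTwist' ι hle ρ₁ σq hc₁ φ'P) b = 0 := by
      intro b hb
      have h1 : toLevelTwist' ι hle ρ₁ σq hc₁ φ'P = FreeAlgebra.lift k gL' P := by
        rw [← toLevelTwist'AlgHom_apply]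
        exact algHom_freeAlgebra_lift (toLevelTwist'AlgHom ι hle ρ₁ σq hc₁) hPTH gL'
          (fun j => toLevelTwist'_heckeProdTwistHom ι hle ρ₁ σq hc₁ (hconj j) (hfin' j)) P
      have h2 : (groupCohomology.map (MonoidHom.id Γ) (A := coeffRep ι (T.level r) ρ₁)
          (B := coeffRep ι (T.level r) ρ₁) (FreeAlgebra.lift k gL' P) b).hom =
          FreeAlgebra.lift k (fun j => heckeEnd ι (T.level r) ρ₁ (δ j) b) P :=
        algHom_freeAlgebra_lift (cohomologyMapAlgHom (coeffRep ι (T.level r) ρ₁) b) gL' _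
          (fun j => rfl) P
      have h3 : FreeAlgebra.lift k (fun j => heckeEnd ι (T.level r) ρ₁ (δ j) b) P = 0 := by
        refine freeAlgebra_lift_heckeEnd_one_eq_zero ι (T.level r) _ δ b P ?_
        refine ArithmeticQuotient.freeAlgebra_lift_heckeEnd_eq_zero_of_equiv ι (T.level r) eN.symm
          δ b P ?_
        refine ArithmeticQuotient.freeAlgebra_lift_heckeEnd_pi_eq_zero ι (T.level r) δ b P ?_
        rw [← hP b hb]
        exact (algHom_freeAlgebra_lift (Pi.evalAlgHom k
          (fun z : TowerIndex => Module.End k (towerCohomology k ι T (p : k) z.1 z.2.1 z.2.2))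
            (b, r, t'))
          (fun j => towerHeckeFamily k ι T (p : k) (δ j)) _ (fun j => rfl) P).symm
      rw [h1]
      apply ModuleCat.hom_ext
      rw [h2, h3, ModuleCat.hom_zero]
    have hnil := pow_succ_map_φZ_levelProdTwist_eq_zero ι hle ρ₁ σq hc₁ φ'P q hφ
    rw [hSP]
    change (((groupCohomology.map (MonoidHom.id Γ) (A := hKerRep W 0) (B := hKerRep W 0)
      (φZ W φ'P 0) q).hom) ^ (q + 1)) (redMap ι hle π M hM (p ^ t') hmod q c) = 0
    rw [hnil, LinearMap.zero_apply]

/-- **An integral Hecke eigenclass of bounded content is a point of `Spf 𝕋` of the tower**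
(the integral continuity step of [Scholze2015, §V.4] / [Emerton2006, §2.2–2.3] in the generic
vocabulary of `CompletedCohomology`; see the module docstring for the statement and the printed
argument).  Hypotheses: `k` with totally ordered divisibility and `p` a non-zero-divisor; `V`
without `p`-torsion; `M ⊂ V` free of rank `d`, stable under `π(L)`; `π(δ j) = 1`; for every `t'`
a level `T.level r ≤ L`, normal in `L`, congruence-trivial on `M/p^{t'}` and Hecke-compatible
with `L`; `c ∈ H^q(Γ, M̃)` an eigenclass of the `[L δⱼ L]` with eigenvalues `χ`, of content
`≤ m₀`. [cite: Scholze2015, §V.4, proofs of Thm. V.4.1 and Cor. V.4.2]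
[cite: Emerton2006, §2.2 and §2.3] [cite: CalegariEmerton2011, §8] -/
theorem isHeckePoint_of_intFun_eigenclass (htot : ∀ a b : k, a ∣ b ∨ b ∣ a)
    (hreg : IsLeftRegular (p : k)) (hV : ∀ v : V, (p : k) • v = 0 → v = 0) {d : ℕ}
    (e : M ≃ₗ[k] (Fin d → k)) (hδ : ∀ j, π (δ j) = 1)
    (hfin : ∀ j, (ArithmeticQuotient.doubleCosetQuot L (δ j)).Finite)
    (hlev : ∀ t' : ℕ, ∃ (r : ℕ) (hle : T.level r ≤ L) (_ : ((T.level r).subgroupOf L).Normal),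
      ModTrivialOn π M hM (p ^ t') (T.level r) ∧
      (∀ (j : J) (l : L), ∃ a ∈ T.level r, ∃ b ∈ T.level r,
        (l : 𝒢) * δ j * (l : 𝒢)⁻¹ = a * δ j * b) ∧
      (∀ j, Set.BijOn (Subgroup.quotientMapOfLE hle)
        (ArithmeticQuotient.doubleCosetQuot (T.level r) (δ j))
        (ArithmeticQuotient.doubleCosetQuot L (δ j))) ∧
      (∀ j, (ArithmeticQuotient.doubleCosetQuot (T.level r) (δ j)).Finite))
    {q : ℕ} (c : groupCohomology (intFun ι L π M) q)
    (heig : ∀ j, (groupCohomology.map (MonoidHom.id Γ) (A := intFun ι L π M) (B := intFun ι L π M)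
      (heckeIntHom ι L π M hM (rep_mem_of_eq_one π M (hδ j))) q).hom c = χ j • c)
    {m₀ : ℕ} (hcont : ∀ (u : ℕ) (y : groupCohomology (intFun ι L π M) q),
      (p : k) ^ u • c ≠ (p : k) ^ (u + m₀) • y) :
    IsHeckePoint ι T (p : k) δ χ := by
  classical
  refine isHeckePoint_of_nilpotentControl.{u, v, u} (ι := ι) (T := T) (ϖ := (p : k)) (δ := δ)
    (χ := χ) fun t => ?_
  obtain ⟨r, hle, hNorm, hmod, hconj, hbij, hfin'⟩ := hlev ((q + 1) * t + m₀)
  haveI := hNorm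
  obtain ⟨H, _, _, S, c', heig', hann, hctrl⟩ := nilpotentControl_at_level ι T p π L M hM δ χ htot
    hV e hδ hfin ((q + 1) * t + m₀) r hle hmod hconj hbij hfin' c heig (Nat.le_add_left m₀ _) hcont
  refine ⟨(Finset.range (q + 1)).image (fun b => (b, r, (q + 1) * t + m₀)), q + 1, (q + 1) * t, H,
    inferInstance, inferInstance, S, c', heig', fun a ha => ?_,
    fun a ha => mem_span_pow_of_pow_mem_span_pow_mul htot hreg (Nat.succ_ne_zero q) ha,
    fun P hP => hctrl P fun b hb => hP _ ?_⟩
  · have h := hann a ha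
    rwa [Nat.add_sub_cancel] at h
  · exact Finset.mem_image.2 ⟨b, Finset.mem_range.2 (Nat.lt_succ_of_le hb), rfl⟩

end Point

end TwistedQuotient

end Literature.NumberTheory.Automorphic
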